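import Literature.NumberTheory.EllipticCurves.Kato2004.AdmissibleZetaClass
import Literature.NumberTheory.EllipticCurves.Kato2004.IwasawaH1LambdaTorsionFreeProofs
import Literature.NumberTheory.EllipticCurves.KatoTwistedFinitenessEulerFactorsProofs
import HarnessLib

/-!
# The POSITION CLAUSE (A6′) of `AdmissibleZetaClassBody` read in the kernel: the multiplier is non-zero,
# an admissible class is COMMENSURABLE with the Λ-adic lift of a Kato family (`L • z₀ = r • y`, `L, r ≠ 0`),
# and the position pins `z₀` up to `Λˣ` FOR A FIXED DATUM — THEOREMS ONLY (no definition, no named fact)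

Topic `NumberTheory/EllipticCurves`, sub-directory `Kato2004` (namespace = path). Cell `bsd-cm`, seat
`bsd-cm-prr-ty1` g4 (literature-prover), on planner pointer D384 (K-CUT-3, «admissible uniqueness up to `Λˣ` …
a 30-line lemma worth filing on its own AFTER (A6′) v2 is accepted»; (A6′) v2 = `AdmissibleZetaClass.lean`,
p617683). A sibling PROOFS file of `Kato2004/AdmissibleZetaClass.lean` (kept out of that file so that its
definitions and their consumers — `Summits/…/Rank1Residual/Additive/KatoDescentClosedBinders.lean` and the two
Kato–Perrin-Riou skeleton lines of items 19945 / 19223 — do not re-elaborate under the two extra imports used here).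
THEOREMS ONLY: no `def`, no named fact, no instance, no notation, no `sorry`; nothing about Kato's Main Conjecture,
Perrin-Riou's conjecture or BSD is asserted.

## What is proved (kernel), and what the audit found is PRINT

* §1 `eulerFactorAtOne_ne_zero`: `P_ℓ(ℓ⁻¹) = 1 − a_ℓ/ℓ + ε(ℓ)/ℓ ≠ 0` for the newform level `N` of `W` and every
  prime `ℓ` (Hasse `a_ℓ² ≤ 4ℓ` at `ℓ ∤ N`, `|a_ℓ| < ℓ` at `ℓ ∣ N`; the tree's complex `eulerFactor_one_ne_zero` at
  `χ(ℓ) = 1`, transported to the rational `eulerFactorAtOne`). `katoMultiplier_ne_zero`: Kato's Λ-adic multiplier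
  `M̃` of (A5′)/(A6′) is a NON-ZERO element of `Λ` — its augmentation is `(R⁻_𝟙/q⁻)·∏_{ℓ∣A,ℓ≠p} ℓ²P_ℓ(ℓ⁻¹) ≠ 0`
  (`constantCoeff_katoMultiplier_cast`, `R⁻_𝟙 ≠ 0` by the guard of (A3), `q⁻ > 0`, §1). This turns the JUNK-AUDIT
  sentence «`M̃ ≠ 0`» of the module docstring of `AdmissibleZetaClass.lean` into a theorem.
* §2 `AdmissibleZetaClassBody.exists_smul_eq_smul_lift` (and its closed form
  `IsAdmissibleZetaClass.exists_smul_eq_smul_lift`): an admissible `z₀` satisfies `L • z₀ = r • y` with `L ≠ 0`,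
  `r ≠ 0` in `Λ`, where `y ∈ I.H` is THE Λ-adic lift (A4) of the `p`-power levels of a Kato family `z` with
  `ZetaBody W p f ι q Λ c d₁ a A z x`, `q ≠ 0` — the CONTENT of the position clause freed of the multiplier
  arithmetic (`L = p^{(−e)⁺}·M̃`, `r = u·p^{e⁺}`). Consequences proved here (kernel): `z₀ = 0 ↔ y = 0`
  (`IwasawaH1Data.eq_zero_iff_of_smul_eq_smul`, with `IwasawaH1Data.noZeroSMulDivisors`); `I.H/Λz₀` is `Λ`-torsion
  iff `I.H/Λy` is (`IwasawaH1Data.isTorsion_quotient_iff_of_smul_eq_smul`; `Λ` a domain) — so non-vanishing and the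
  rank-one clause of the Kato descent readings may be checked on the lift `y` of the family instead of on `z₀`.
* §3 `IwasawaH1Data.eq_units_smul_of_smul_eq_smul` — RIGIDITY OF THE POSITION FOR A FIXED DATUM: in the
  torsion-free `Λ`-module `𝐇¹_Γ(T_pW)` (`γ` a topological generator), `L • z = (u·r) • y` and `L • z′ = (u′·r) • y`
  with `L ≠ 0` and units `u, u′` force `z′ = (u⁻¹u′) • z`. This is exactly what «(A6′) + `noZeroSMulDivisors` +
  `M̃ ≠ 0`» buys: two classes admissible THROUGH THE SAME WITNESS DATA `(f, ι, q, Λ, d, c, d₁, a, A, d′, z, y, e)`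
  differ by a unit of `Λ`.

AUDIT (numbers, not adjectives; seat prr-ty1 g4, 2026-08-28). The statement «any two admissible classes of the same
`I` differ by a unit of `Λ`» — i.e. `IsAdmissibleZetaClass … z₀ → IsAdmissibleZetaClass … z₀′ → ∃ w : Λˣ, z₀′ = w • z₀`,
the form the `←` half of the interface reading `ReadsTrivialKMC` (stub 5 of the lines `kato_perrin_riou_zp` /
`kato_perrin_riou_istar`) would consume — is NOT §3: the two admissibility witnesses are INDEPENDENT existentials
(their own newform level, embeddings `ι`, constant `q`, value datum `Λ`, Néron generator `d`, Kato parameters, family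
`z`, lift `y`, multiplier), and relating `y′` to `y` is Kato's own argument of p. 230 (lines 4–6: «Since `𝐇¹(V_{F_λ}(f))`
is a free `Λ[1/p]`-module of rank 1 (Thm. 12.4 (2)), this shows that `z_γ^{(p)}` is independent of the choices of
`α₁, j₁, α₂, j₂, c, d`»; Lemma 13.10, proof: «By Thm. 12.4 (2), this is obtained by computing the images … under the
map (13.7.1) by using Thm. 6.6 and Thm. 9.7»): elements of the rank-one module `𝐇¹ ⊗ ℚ` are compared through their
dual-exponential values at almost all finite-order characters, non-zero for almost all of them (Prop. 13.7 via
Thm. 13.5 (2) = Rohrlich, p. 227). Tree inventory for that argument: torsion-freeness of `𝐇¹_Γ` — THEOREM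
(`IwasawaH1Data.noZeroSMulDivisors`); uniqueness of the lift GIVEN the family — THEOREM
(`IwasawaH1Data.existsUnique_lift_of_zetaBody`); `𝐇¹ ⊗ ℚ` free of rank one — NAMED FACT only (`Kato2004.thm12_4`,
rank `≤ 1` proved under `rank_integralH1_le_one` in `IwasawaH1RankLeOneProofs`); a `Λ`-adic value map on `I.H`
through which (C4)/(C5) are read with «equal values at almost all `χ` ⇒ equal» — ABSENT (the tree reads values level
by level through the witness `Λ_{k,r}`, and `loc_p`-kernel control exists at the bottom layer only,
`locP_kernel_isTorsion_of_rankOne_holds`); Rohrlich's generic non-vanishing of `L(f, χ, 1)` — ABSENT as a theorem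
(the Barriers fact `padicLFunction_ne_zero` is its `p`-adic-`L` avatar, not the twisted values). Hence the
cross-witness statement is PRINT (size L–XL in this tree, at least two inputs not in the kernel), not a 30-line
lemma; this file proves the same-witness part and the multiplier facts and books nothing.

References: K. Kato, Astérisque 295 (2004): Thm. 12.4 (2) (p. 221), Thm. 12.5 (1) (pp. 221–222), Conj. 12.10
(p. 224), Ex. 13.3 (p. 225), Thm. 13.5 (2) and Prop. 13.7 with (13.7.1) (p. 227), §13.8 (p. 228), §13.9 and
Lemma 13.10 (1) (pp. 229–230) [Kato2004Asterisque] (store text `paper:doi-10-24033-ast-639`, pp. 106–115, re-read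
2026-08-28); J. H. Silverman, AEC, Thm. V.1.1 (Hasse) [SilvermanAEC2009]; D. Rohrlich, Invent. Math. 75 (1984)
409–423 [RohrlichInventiones1984]; tree: `Kato2004/AdmissibleZetaClass.lean` (`katoMultiplier`,
`constantCoeff_katoMultiplier_cast`, `AdmissibleZetaClassBody`, `isAdmissibleZetaClass_iff`),
`Kato2004/MemberMultiplierInputs.lean` (`eulerFactorAtOne`, `ratCuspFactor`),
`Kato2004/IwasawaH1LambdaTorsionFreeProofs.lean` (`IwasawaH1Data.noZeroSMulDivisors`),
`KatoTwistedFinitenessEulerFactorsProofs.lean` (`eulerFactor_one_ne_zero`); design record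
`pub/bsd-cm/bsd-cm-prr-ty1/UNIQUENESS-AUDIT.md`.
-/

noncomputable section

open scoped BigOperators NumberField TensorProduct Classical
open Field IsDedekindDomain NumberField CongruenceSubgroup ValuativeRel
open Literature.NumberTheory.GaloisRepresentations
open Literature.NumberTheory.GaloisRepresentations.PeriodRingData
open Literature.NumberTheory.GaloisRepresentations.IsNonarchimedeanLocalField
open Literature.NumberTheory.PAdicHodge
open Literature.NumberTheory.EllipticCurves Literature.NumberTheory.EllipticCurves.ModularForms
open Literature.NumberTheory.AdelicBaseChange Literature.NumberTheory.Automorphic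

namespace Literature.NumberTheory.EllipticCurves.Kato2004

open EulerSystemValues Rat.HeightOneSpectrum

/-! ## §1 The multiplier is non-zero -/

section Multiplier

variable (p : ℕ) [Fact p.Prime]

/-- **`P_ℓ(ℓ⁻¹) ≠ 0`**: the Euler factor of `L(W, s)` at a prime `ℓ`, evaluated at `s = 1` and written for the
level `N` of the newform `f` of `W` (`eulerFactorAtOne W N ℓ = 1 − a_ℓ/ℓ + ε(ℓ)/ℓ`, `ε(ℓ) = 0` iff `ℓ ∣ N`), does
not vanish: `ℓ²P_ℓ(ℓ⁻¹) = ℓ² − a_ℓℓ + ε(ℓ)ℓ = 0` would force `a_ℓ = ℓ + 1` at `ℓ ∤ N` (against Hasse `a_ℓ² ≤ 4ℓ`)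
or `a_ℓ = ℓ` at `ℓ ∣ N` (against `|a_ℓ| < ℓ` there). Transport of the tree's complex statement
`eulerFactor_one_ne_zero` (at `χ(ℓ) = 1`) to the rational `eulerFactorAtOne`.
[cite: Kato2004Asterisque, Ex. 13.3 (p. 225)] [cite: SilvermanAEC2009, Thm. V.1.1] -/
theorem eulerFactorAtOne_ne_zero (W : WeierstrassCurve ℚ) [W.IsElliptic] {N : ℕ} [NeZero N]
    {f : CuspForm (Gamma0 N) 2} (hf : IsNewformOf W f) {ℓ : ℕ} (hℓ : ℓ.Prime) :
    eulerFactorAtOne W N ℓ ≠ 0 := by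
  intro h0
  have hℓ0 : (ℓ : ℂ) ≠ 0 := Nat.cast_ne_zero.mpr hℓ.ne_zero
  have key : (1 : ℂ) - 1 * cuspCoeff f ℓ * (ℓ : ℂ)⁻¹ +
      (if ℓ ∣ N then 0 else (ℓ : ℂ)) * 1 ^ 2 * ((ℓ : ℂ)⁻¹) ^ 2 = ((eulerFactorAtOne W N ℓ : ℚ) : ℂ) := by
    rw [hf.2 ℓ]
    unfold eulerFactorAtOne
    split_ifs
    · push_cast
      field_simp
      ring
    · push_cast
      field_simp
  exact eulerFactor_one_ne_zero hf hℓ (c := 1) (by simp) (by rw [key, h0, Rat.cast_zero])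

/-- **Kato's Λ-adic multiplier is non-zero.** For the newform `f` of `W` (level `N`), parameters `(c, d₁, a, A, d′)`
with `R⁻_𝟙 = ratCuspFactor f true c d₁ a A d′ ≠ 0`, a non-zero `q⁻` and the integer coordinates `nᵢ` of the four cusp
symbols in `ℤ·q⁻` (the data (A3)/(A5′) of `AdmissibleZetaClassBody`), and ANY Galois elements `σ_c, σ_{d₁}, σ_ℓ`:
`M̃ = katoMultiplier p c d₁ n₁ n₂ n₃ n₄ Ψ(σ_c) Ψ(σ_{d₁}) (prime(A) ∖ {p}) a_• ε_• (Ψ ∘ σ_•) ≠ 0` in `Λ`, because its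
augmentation is `(R⁻_𝟙/q⁻)·∏_{ℓ ∣ A, ℓ ≠ p} ℓ²P_ℓ(ℓ⁻¹) ≠ 0` (`constantCoeff_katoMultiplier_cast`,
`eulerFactorAtOne_ne_zero`). [cite: Kato2004Asterisque, Lemma 13.10 (1) (p. 230), Ex. 13.3 (p. 225)] -/
theorem katoMultiplier_ne_zero (W : WeierstrassCurve ℚ) [W.IsElliptic] {N : ℕ} [NeZero N]
    {f : CuspForm (Gamma0 N) 2} (hf : IsNewformOf W f) (K : ZpExtension ℚ p) (c d a : ℤ) (A : ℕ) (d' : ℤ)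
    {qm : ℚ} (hqm : qm ≠ 0) {n₁ n₂ n₃ n₄ : ℤ}
    (h₁ : ratMinusSymbol f ((a : ℚ) / A) = n₁ * qm) (h₂ : ratMinusSymbol f ((a * c : ℚ) / A) = n₂ * qm)
    (h₃ : ratMinusSymbol f ((a * d' : ℚ) / A) = n₃ * qm) (h₄ : ratMinusSymbol f ((a * c * d' : ℚ) / A) = n₄ * qm)
    (hR : ratCuspFactor f true c d a A d' ≠ 0)
    (σc σd : absoluteGaloisGroup ℚ) (σℓ : ℕ → absoluteGaloisGroup ℚ) :
    katoMultiplier p c d n₁ n₂ n₃ n₄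
        ((IwasawaCharacter.Psi p ℤ_[p] K σc : (PowerSeries ℤ_[p])ˣ) : IwasawaAlgebra p)
        ((IwasawaCharacter.Psi p ℤ_[p] K σd : (PowerSeries ℤ_[p])ˣ) : IwasawaAlgebra p)
        (A.primeFactors.erase p) (fun ℓ => W.LFunction ℓ) (fun ℓ => if ℓ ∣ N then 0 else 1)
        (fun ℓ => ((IwasawaCharacter.Psi p ℤ_[p] K (σℓ ℓ) : (PowerSeries ℤ_[p])ˣ) : IwasawaAlgebra p)) ≠ 0 := by
  intro h0
  have hc := constantCoeff_katoMultiplier_cast p W f K c d a A d' hqm h₁ h₂ h₃ h₄ σc σd σℓ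
  rw [h0, map_zero, PadicInt.coe_zero] at hc
  have hrat : ratCuspFactor f true c d a A d' / qm *
      ∏ ℓ ∈ A.primeFactors.erase p, ((ℓ : ℚ) ^ 2 * eulerFactorAtOne W N ℓ) ≠ 0 := by
    refine mul_ne_zero (div_ne_zero hR hqm) (Finset.prod_ne_zero_iff.mpr fun ℓ hℓ => ?_)
    have hℓp : ℓ.Prime := Nat.prime_of_mem_primeFactors (Finset.mem_of_mem_erase hℓ)
    exact mul_ne_zero (pow_ne_zero _ (Nat.cast_ne_zero.mpr hℓp.ne_zero)) (eulerFactorAtOne_ne_zero W hf hℓp)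
  exact hrat (by exact_mod_cast hc.symm)

/-- `p ≠ 0` in `Λ = ℤ_p⟦T⟧` (its augmentation is `p ≠ 0` in `ℤ_p`). [folklore] -/
private theorem natCast_prime_ne_zero_iwasawaAlgebra : (p : IwasawaAlgebra p) ≠ 0 := by
  intro h
  have h' := congr_arg PowerSeries.constantCoeff h
  rw [map_natCast, map_zero] at h'
  exact (Fact.out : p.Prime).ne_zero (by exact_mod_cast h')

/-- The left scalar of the position clause (A6′), `p^{(−e)⁺}·M̃`, is non-zero as soon as `M̃` is (`Λ` is a domain).
[cite: Kato2004Asterisque, Lemma 13.10 (1) (p. 230)] -/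
theorem pow_mul_ne_zero_of_ne_zero {M : IwasawaAlgebra p} (hM : M ≠ 0) (k : ℕ) :
    (p : IwasawaAlgebra p) ^ k * M ≠ 0 :=
  mul_ne_zero (pow_ne_zero _ (natCast_prime_ne_zero_iwasawaAlgebra p)) hM

/-- The right scalar of the position clause (A6′), `u·p^{e⁺}` with `u ∈ Λˣ`, is non-zero. [folklore] -/
private theorem units_mul_pow_ne_zero (u : (IwasawaAlgebra p)ˣ) (k : ℕ) :
    (u : IwasawaAlgebra p) * (p : IwasawaAlgebra p) ^ k ≠ 0 :=
  mul_ne_zero u.ne_zero (pow_ne_zero _ (natCast_prime_ne_zero_iwasawaAlgebra p))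

end Multiplier

/-! ## §2 The content of the position clause: `L • z₀ = r • y`, `L, r ≠ 0`, `y` the lift of a Kato family -/

section Content

variable {W : WeierstrassCurve ℚ} [W.IsElliptic] [W.IsGloballyMinimal] {p : ℕ} [Fact p.Prime]
  [ContinuousSMul ℤ_[p] (W.tateModule p)] [Module.Free ℤ_[p] (W.tateModule p)]
  [Module.Finite ℤ_[p] (W.tateModule p)] {K : ZpExtension ℚ p} {hK : K.IsCyclotomic}
  {γ : absoluteGaloisGroup ℚ} {I : IwasawaH1Data W p K γ} {z₀ : I.H}

/-- **The content of (A6′).** If `z₀ ∈ I.H = 𝐇¹_Γ(T_pW)` is admissible (`AdmissibleZetaClassBody`), then there are: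
`p ≠ 2`, the newform `f` of `W` (level `N`), embeddings `ι`, a constant `q ≠ 0` and a value datum `Λ`, Kato
parameters `(c, d₁, a, A)`, a family `(z, x)` with `ZetaBody W p f ι q Λ c d₁ a A z x`, its Λ-adic lift `y ∈ I.H`
(`I.proj n y = Cor(z_{n+1,∅})` for every `n`), and NON-ZERO `L, r ∈ Λ` with `L • z₀ = r • y`. (Here
`L = p^{(−e)⁺}·M̃ ≠ 0` by `katoMultiplier_ne_zero`, `r = u·p^{e⁺}`.) The finer witnesses ((A1)–(A2), the guards,
(A5′), `e`, `u`) are discarded. Kernel. [cite: Kato2004Asterisque, Thm. 12.5 (1) (pp. 221–222), Lemma 13.10 (1) (p. 230)] -/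
theorem AdmissibleZetaClassBody.exists_smul_eq_smul_lift (h : AdmissibleZetaClassBody W p K hK I z₀) :
    ∃ (hp : p ≠ 2) (N : ℕ) (_ : NeZero N) (f : CuspForm (Gamma0 N) 2) (_ : IsNewformOf W f)
      (ι : (n : ℕ) → (CyclotomicField n ℚ →+* ℂ)) (q : ℚ)
      (Λ : ∀ (k : ℕ) (r : Finset (HeightOneSpectrum (𝓞 ℚ))),
        H1 (tateRep W p) (cycSubgroup p k r) →ₗ[ℤ_[p]] ℚ_[p] ⊗[ℚ] CyclotomicField (cycLevel p k r) ℚ)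
      (c d₁ a : ℤ) (A : ℕ)
      (z : ∀ (k : ℕ) (r : (cyclotomicLevelsRat p (badPlaces c d₁ A N)).Ideals),
        H1 (tateRep W p) ((cyclotomicLevelsRat p (badPlaces c d₁ A N)).level k r.1))
      (x : ∀ (k : ℕ) (r : (cyclotomicLevelsRat p (badPlaces c d₁ A N)).Ideals),
        CyclotomicField (cycLevel p k r.1) ℚ)
      (y : I.H) (L r : IwasawaAlgebra p),
      q ≠ 0 ∧ ZetaBody W p f ι ((q : ℚ) : ℝ) Λ c d₁ a A z x ∧
      (∀ n : ℕ, I.proj n y =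
        levelToLayer W p hK hp (badPlaces c d₁ A N) n
          (z (n + 1) (cyclotomicLevelsRat p (badPlaces c d₁ A N)).idealOne)) ∧
      L ≠ 0 ∧ r ≠ 0 ∧ L • z₀ = r • y := by
  obtain ⟨hp, N, hN, f, hf, ι, q, Λ, hq, -, c, d₁, a, A, d', -, -, -, -, hR, z, x, hzeta, y, hy,
    qm, perRatio, e, u, n₁, n₂, n₃, n₄, σc, σd, σℓ, hqm, -, h₁, h₂, h₃, h₄, -, -, -, -, -, -,
    hpos⟩ := h
  exact ⟨hp, N, hN, f, hf, ι, q, Λ, c, d₁, a, A, z, x, y, _, _, hq, hzeta, hy,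
    pow_mul_ne_zero_of_ne_zero p
      (katoMultiplier_ne_zero p W hf K c d₁ a A d' hqm.ne' h₁ h₂ h₃ h₄ hR σc σd σℓ) _,
    units_mul_pow_ne_zero p u _, hpos⟩

omit [Module.Free ℤ_[p] (W.tateModule p)] [Module.Finite ℤ_[p] (W.tateModule p)] in
/-- **The content of (A6′), closed form** (any instances of the two `Prop`-valued structure facts, as in
`isAdmissibleZetaClass_iff`): an admissible zeta class `z₀` of `I` satisfies `L • z₀ = r • y` with `L, r ≠ 0` and `y`
the Λ-adic lift of a Kato family into `I`. [cite: Kato2004Asterisque, Thm. 12.5 (1) (pp. 221–222), Lemma 13.10 (1) (p. 230)] -/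
theorem IsAdmissibleZetaClass.exists_smul_eq_smul_lift [Module.Free ℤ_[p] (W.tateModule p)]
    [Module.Finite ℤ_[p] (W.tateModule p)] (h : IsAdmissibleZetaClass W p K hK I z₀) :
    ∃ (hp : p ≠ 2) (N : ℕ) (_ : NeZero N) (f : CuspForm (Gamma0 N) 2) (_ : IsNewformOf W f)
      (ι : (n : ℕ) → (CyclotomicField n ℚ →+* ℂ)) (q : ℚ)
      (Λ : ∀ (k : ℕ) (r : Finset (HeightOneSpectrum (𝓞 ℚ))),
        H1 (tateRep W p) (cycSubgroup p k r) →ₗ[ℤ_[p]] ℚ_[p] ⊗[ℚ] CyclotomicField (cycLevel p k r) ℚ)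
      (c d₁ a : ℤ) (A : ℕ)
      (z : ∀ (k : ℕ) (r : (cyclotomicLevelsRat p (badPlaces c d₁ A N)).Ideals),
        H1 (tateRep W p) ((cyclotomicLevelsRat p (badPlaces c d₁ A N)).level k r.1))
      (x : ∀ (k : ℕ) (r : (cyclotomicLevelsRat p (badPlaces c d₁ A N)).Ideals),
        CyclotomicField (cycLevel p k r.1) ℚ)
      (y : I.H) (L r : IwasawaAlgebra p),
      q ≠ 0 ∧ ZetaBody W p f ι ((q : ℚ) : ℝ) Λ c d₁ a A z x ∧
      (∀ n : ℕ, I.proj n y =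
        levelToLayer W p hK hp (badPlaces c d₁ A N) n
          (z (n + 1) (cyclotomicLevelsRat p (badPlaces c d₁ A N)).idealOne)) ∧
      L ≠ 0 ∧ r ≠ 0 ∧ L • z₀ = r • y :=
  ((isAdmissibleZetaClass_iff W p K hK I z₀).mp h).exists_smul_eq_smul_lift

omit [W.IsGloballyMinimal] [Module.Free ℤ_[p] (W.tateModule p)] [Module.Finite ℤ_[p] (W.tateModule p)] in
/-- **From the content: `z₀ = 0 ↔ y = 0`** for a position `L • z₀ = r • y` with `L, r ≠ 0` in the torsion-free
`Λ`-module `𝐇¹_Γ(T_pW)` (`γ` a topological generator; `IwasawaH1Data.noZeroSMulDivisors`). In particular an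
admissible class vanishes iff the Λ-adic lift of its Kato family does.
[cite: Kato2004Asterisque, Thm. 12.4 (2) (p. 221)] -/
theorem IwasawaH1Data.eq_zero_iff_of_smul_eq_smul (hγ : K.IsTopGenerator γ) (I : IwasawaH1Data W p K γ)
    {L r : IwasawaAlgebra p} (hL : L ≠ 0) (hr : r ≠ 0) {z y : I.H} (h : L • z = r • y) :
    z = 0 ↔ y = 0 := by
  haveI := I.noZeroSMulDivisors hγ
  constructor
  · rintro rfl
    rw [smul_zero] at h
    exact (smul_eq_zero.mp h.symm).resolve_left hr
  · rintro rfl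
    rw [smul_zero] at h
    exact (smul_eq_zero.mp h).resolve_left hL

omit [W.IsGloballyMinimal] [Module.Free ℤ_[p] (W.tateModule p)] [Module.Finite ℤ_[p] (W.tateModule p)] in
/-- One direction of `isTorsion_quotient_iff_of_smul_eq_smul`, needing only `L ≠ 0`: if `L • z = r • y` and
`𝐇¹_Γ/Λz` is `Λ`-torsion then so is `𝐇¹_Γ/Λy` (`s•m = t•z ⇒ (Ls)•m = (tr)•y`; `Λ` is a domain). [folklore] -/
private theorem IwasawaH1Data.isTorsion_quotient_of_smul_eq_smul (I : IwasawaH1Data W p K γ)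
    {L r : IwasawaAlgebra p} (hL : L ≠ 0) {z y : I.H} (h : L • z = r • y)
    (hT : Module.IsTorsion (IwasawaAlgebra p) (I.H ⧸ (IwasawaAlgebra p) ∙ z)) :
    Module.IsTorsion (IwasawaAlgebra p) (I.H ⧸ (IwasawaAlgebra p) ∙ y) := by
  intro m
  obtain ⟨m, rfl⟩ := Submodule.Quotient.mk_surjective _ m
  obtain ⟨⟨s, hs⟩, hsm⟩ := @hT (Submodule.Quotient.mk m : I.H ⧸ (IwasawaAlgebra p) ∙ z)
  have hsm' : s • m ∈ (IwasawaAlgebra p) ∙ z := by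
    rw [← Submodule.Quotient.mk_eq_zero, Submodule.Quotient.mk_smul]
    exact hsm
  obtain ⟨t, ht⟩ := Submodule.mem_span_singleton.mp hsm'
  refine ⟨⟨L * s, mul_mem (mem_nonZeroDivisors_of_ne_zero hL) hs⟩, ?_⟩
  change (L * s) • (Submodule.Quotient.mk m : I.H ⧸ (IwasawaAlgebra p) ∙ y) = 0
  rw [← Submodule.Quotient.mk_smul, Submodule.Quotient.mk_eq_zero, mul_smul, ← ht, smul_comm L t z, h,
    smul_smul]
  exact Submodule.mem_span_singleton.mpr ⟨t * r, rfl⟩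

omit [W.IsGloballyMinimal] [Module.Free ℤ_[p] (W.tateModule p)] [Module.Finite ℤ_[p] (W.tateModule p)] in
/-- **From the content: `𝐇¹_Γ/Λz₀` is `Λ`-torsion iff `𝐇¹_Γ/Λy` is**, for a position `L • z₀ = r • y` with
`L, r ≠ 0` — so the rank-one clause «`𝐇¹_Γ/Λz₀` torsion» of the Kato descent readings may be checked on the lift `y`
of the Kato family instead of the admissible class. [cite: Kato2004Asterisque, Thm. 12.4 (2) (p. 221), Thm. 12.5 (2) (p. 222)] -/
theorem IwasawaH1Data.isTorsion_quotient_iff_of_smul_eq_smul (I : IwasawaH1Data W p K γ)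
    {L r : IwasawaAlgebra p} (hL : L ≠ 0) (hr : r ≠ 0) {z y : I.H} (h : L • z = r • y) :
    Module.IsTorsion (IwasawaAlgebra p) (I.H ⧸ (IwasawaAlgebra p) ∙ z) ↔
      Module.IsTorsion (IwasawaAlgebra p) (I.H ⧸ (IwasawaAlgebra p) ∙ y) :=
  ⟨I.isTorsion_quotient_of_smul_eq_smul hL h, I.isTorsion_quotient_of_smul_eq_smul hr h.symm⟩

end Content

/-! ## §3 Rigidity of the position for a FIXED datum (same-witness uniqueness up to `Λˣ`) -/

section Rigidity

variable {W : WeierstrassCurve ℚ} [W.IsElliptic] {p : ℕ} [Fact p.Prime]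
  [ContinuousSMul ℤ_[p] (W.tateModule p)] {K : ZpExtension ℚ p} {γ : absoluteGaloisGroup ℚ}

/-- **Rigidity of the position clause for a fixed datum.** In `𝐇¹_Γ(T_pW)` (torsion-free over `Λ`, `γ` a
topological generator): if `L • z = (u·r) • y` and `L • z′ = (u′·r) • y` with `L ≠ 0` in `Λ` and `u, u′ ∈ Λˣ`, then
`z′ = (u⁻¹u′) • z`. With `L = p^{(−e)⁺}·M̃` (`≠ 0`, §1), `r = p^{e⁺}` and `y` the lift (A4), this says: two classes
admissible THROUGH THE SAME WITNESS DATA differ by a unit of `Λ` — the same-witness part of «admissible classes form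
one `Λˣ`-orbit»; the cross-witness part is print (module docstring AUDIT: Kato p. 230 via Thm. 12.4 (2) and (13.7.1)).
[cite: Kato2004Asterisque, Thm. 12.4 (2) (p. 221), §13.9 (p. 230, lines 4–6)] -/
theorem IwasawaH1Data.eq_units_smul_of_smul_eq_smul (hγ : K.IsTopGenerator γ) (I : IwasawaH1Data W p K γ)
    {L r : IwasawaAlgebra p} (hL : L ≠ 0) {u u' : (IwasawaAlgebra p)ˣ} {z z' y : I.H}
    (h : L • z = ((u : IwasawaAlgebra p) * r) • y) (h' : L • z' = ((u' : IwasawaAlgebra p) * r) • y) :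
    z' = ((u⁻¹ * u' : (IwasawaAlgebra p)ˣ) : IwasawaAlgebra p) • z := by
  haveI := I.noZeroSMulDivisors hγ
  have key : L • ((u : IwasawaAlgebra p) • z') = L • ((u' : IwasawaAlgebra p) • z) := by
    rw [smul_smul, smul_smul, mul_comm L, mul_comm L, ← smul_smul, ← smul_smul, h, h', smul_smul, smul_smul]
    congr 1
    ring
  have h2 : (u : IwasawaAlgebra p) • z' = (u' : IwasawaAlgebra p) • z := smul_right_injective I.H hL key
  calc z' = ((u⁻¹ * u : (IwasawaAlgebra p)ˣ) : IwasawaAlgebra p) • z' := by rw [inv_mul_cancel, Units.val_one, one_smul]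
    _ = ((u⁻¹ : (IwasawaAlgebra p)ˣ) : IwasawaAlgebra p) • ((u : IwasawaAlgebra p) • z') := by
        rw [Units.val_mul, mul_smul]
    _ = ((u⁻¹ : (IwasawaAlgebra p)ˣ) : IwasawaAlgebra p) • ((u' : IwasawaAlgebra p) • z) := by rw [h2]
    _ = ((u⁻¹ * u' : (IwasawaAlgebra p)ˣ) : IwasawaAlgebra p) • z := by rw [Units.val_mul, mul_smul]

/-- Existential form of the rigidity: same-witness admissible classes differ by SOME unit of `Λ`.
[cite: Kato2004Asterisque, Thm. 12.4 (2) (p. 221), §13.9 (p. 230, lines 4–6)] -/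
theorem IwasawaH1Data.exists_units_smul_of_smul_eq_smul (hγ : K.IsTopGenerator γ) (I : IwasawaH1Data W p K γ)
    {L r : IwasawaAlgebra p} (hL : L ≠ 0) {u u' : (IwasawaAlgebra p)ˣ} {z z' y : I.H}
    (h : L • z = ((u : IwasawaAlgebra p) * r) • y) (h' : L • z' = ((u' : IwasawaAlgebra p) * r) • y) :
    ∃ w : (IwasawaAlgebra p)ˣ, z' = (w : IwasawaAlgebra p) • z :=
  ⟨u⁻¹ * u', I.eq_units_smul_of_smul_eq_smul hγ hL h h'⟩

end Rigidity

end Literature.NumberTheory.EllipticCurves.Kato2004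

end
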